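import Summits.BirchSwinnertonDyer.BirchSwinnertonDyer.Theorems.ErratumRoadFiveNonSurjCornerHybridDeepWitnessCore
import HarnessLib

/-!
# Route `ErratumRoadFive` (rung K2), crux `NonSurjCorner` (item stmt-BirchSwinnertonDyer-19065), line `Lines/hybrid.lean`:
# THE ∃-RECUT OF THE EULER HALF'S TWIN INPUT — the MAX road keyed on ONE twin-lower SUPPLY per pair (SOME Heegner field with `2` split carrying the
# twist's `≥`-half), and the hybrid composition with NO ∀-shaped twin input left (cf. lane B's `CornerTwinLowerModEightAt` ∕ `FHTwinLowerSupplyAt` at 3)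
# (cell `bsd-stepL`, seat `bsd-stepL-corner-p1` g18; `--supports stmt-BirchSwinnertonDyer-19065 --as helper`)

WHY THIS FILE. After `…HybridDeepWitnessCore` (p643302) the converse half of a corner pair is ONE ∃-shaped deep witness. On the Euler side the twin's
LOWER half still entered ∀-shaped: `h₄ℓ` = the `≥`-half of EVERY non-surjective X11a leaf twin whose `#Ш_an` is not a `p`-unit — on the line of record
produced from μ = 0 (slot 2′ = (2a)) through the six Hida facts (slot 4), or from crux 19064. But its two consumers are frame-existential: the MULTI-carrier
inert road already takes the ∃-supply `FHTwinLowerSupplyAt W p` (one Friedberg–Hoffstein field per even set of multiplicative primes, with the twist's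
`≥`-display), and the MAX road (t = 0 ∕ mono-carrier pairs) uses ONE Heegner field with `2` split. So, as lane B did at 3 (`CornerTwinLowerModEightAt`,
RULING 40-series), the MAX road is re-keyed here on an ∃-supply, and the composition then has NO ∀-shaped twin input: per corner pair the Euler side asks
two supplies (inert frames ∕ MAX frame), each ONE computation's worth of data (a Heegner `d_K` with `p ∤ #Ш(E^{(d_K)})_an` makes the `≥`-half trivial),
and the converse side asks the deep witness at the deep pairs only. Slot 4 (six Hida facts) and the one-prime Friedberg–Hoffstein fact then serve only
to DERIVE the supplies from μ = 0 (compatibility), not the composition.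
* §1 `X11b.missingUpperBoundAt_corner_of_jetchevDivisibility_of_maxTwinLowerSupply_of_casselsTate` — the Cha-free MAX road on the supplied frame;
* §2 `X11b.erratumRoadFive_nonSurjCorner_of_deepWitness_of_kolyJMax_of_multiUpper_of_maxTwinLowerSupply_of_twinUpper_of_casselsTate` — the composition.

HONEST FRAMING: TWO THEOREMS (no definition, no named fact, no `sorry`); CONDITIONAL on every displayed binder; no stub is proved — an open input is
asked existentially instead of universally; 19065 NOT closed by this file; nothing about any curve's BSD; BSD is not advanced; T7.
References (locators only): [cite: Cha2005, Thm. 21 and Rmk. 25] [cite: McCallumLMS1991, §5 Cor. 5.6] [cite: HoffsteinLuo1997, Theorem (§1)]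
[cite: JetchevSkinnerWan2017, §7.4.1–7.4.2] [cite: GrossLMS1991, §3 Prop. 3.7 (2)] [cite: Miller2011LMS, Def. 1.1].
-/

set_option autoImplicit false
set_option linter.dupNamespace false -- `Summit.BirchSwinnertonDyer.BirchSwinnertonDyer` (summit = problem), tree-wide

noncomputable section

open scoped Classical NumberField MatrixGroups ModularForm

/-! ### §1 The MAX road keyed on an ∃-shaped twin-lower supply -/

namespace Summit.BirchSwinnertonDyer.Rank1Residual.X11b

open CongruenceSubgroup WeierstrassCurve NumberField IsDedekindDomain Field
  Literature.NumberTheory.EllipticCurves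
  Literature.NumberTheory.EllipticCurves.ModularForms
  Literature.NumberTheory.EllipticCurves.Rank1Residual
  Literature.NumberTheory.EllipticCurves.Rank1Residual.Typed
  Literature.NumberTheory.EllipticCurves.Wuthrich2014
  Literature.NumberTheory.EllipticCurves.SteinWuthrich2013
  Literature.NumberTheory.EllipticCurves.GreenbergVatsal2000
  Literature.NumberTheory.EllipticCurves.EmertonPollackWeston2006
  Literature.NumberTheory.QuadraticFields.Quadratic
  Literature.NumberTheory.GaloisRepresentations
  Summit.BirchSwinnertonDyer.Rank1Residual
  Summit.BirchSwinnertonDyer.Rank1Residual.RankZeroHeightFree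
  Summit.BirchSwinnertonDyer.Rank1Residual.X11b.Three.Koly
  Summit.BirchSwinnertonDyer.BirchSwinnertonDyer.Theorems

/-- **The Cha-free MAX road keyed on an ∃-shaped TWIN-LOWER SUPPLY** (cf. lane B's `CornerTwinLowerModEightAt` at 3). Same statement and proof as
`missingUpperBoundAt_corner_of_jetchevDivisibility_of_twinLeafLower_of_casselsTate'` (g17, p630826) except that the two twin-side inputs — the one-prime
Friedberg–Hoffstein fact `hFHs` (which CHOSE the Heegner field `K` with `2` split, `|d_K| > 4`, `L(E^{(d_K)},1) ≠ 0`) and the `≥`-half `hLtw` of EVERY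
non-surjective X11a leaf twin — are replaced by ONE ∃-shaped supply `hSup` of this pair: SOME such field `K` TOGETHER WITH the `≥`-half of the twist
`E^{(d_K)}` at its globally minimal models. Per pair the supply is ONE computation (a Heegner `d_K ≡ 1 (mod 8)` with `p ∤ #Ш(E^{(d_K)})_an` makes the
`≥`-half trivial); class-wide it is Friedberg–Hoffstein + the X11a lower half, asked existentially. The Jetchev direction `hJ`, Cha's structure bound
(KERNEL, corner3-p2 g11), the Cassels–Tate level inputs and Gross 3.7 (2) as before. CONDITIONAL; nothing booked.
[cite: Cha2005, Thm. 21 and Rmk. 25 (pp. 173–175)] [cite: HoffsteinLuo1997, Theorem (§1)] [cite: JetchevSkinnerWan2017, §7.4.2] [cite: GrossLMS1991, §3 Prop. 3.7 (2)] -/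
theorem missingUpperBoundAt_corner_of_jetchevDivisibility_of_maxTwinLowerSupply_of_casselsTate
    (hGZ : ∀ (N : ℕ) [NeZero N] (W : WeierstrassCurve ℚ) (K : Type) [Field K] [NumberField K],
      gross_zagier N W K)
    (hKo : ∀ (N : ℕ) [NeZero N] (W : WeierstrassCurve ℚ) (K : Type) [Field K] [NumberField K],
      kolyvagin N W K)
    (hGZK : rank_eq_analyticRank_of_analyticRank_le_one) (hmod : hasEntireLFunction_rat)
    (hnf : exists_isNewformOf)
    (hMaz : mazur_not_dvd_maninConstant_of_odd)
    (hrec : ∀ (N : ℕ) [NeZero N] (W : WeierstrassCurve ℚ) (K : Type) [Field K] [NumberField K],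
      heegnerPointOfConductor_one_galoisConj N W K)
    (hD36 : ∀ (N : ℕ) [NeZero N] (W : WeierstrassCurve ℚ) (K : Type) [Field K] [NumberField K],
      phi_heegnerTau_mem_singularModuliField N W K)
    (hCT : ∀ (K : Type) [Field K] [NumberField K], casselsTate_levelInputs K)
    (h372 : GrossLMS1991.prop37_2_frobeniusCongruence)
    (W : WeierstrassCurve ℚ) [W.IsElliptic] [W.IsGloballyMinimal] (p : ℕ) [Fact p.Prime]
    (hX : ClassX11b W p) (hns : ¬ Surj W p) (h57 : p = 5 ∨ p = 7)
    (hv : p ∣ padicValInt p W.minimalDiscriminantInt) (hnr : ¬ Ram W p)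
    -- the MAX-frame TWIN-LOWER SUPPLY of this pair (∃-shape): SOME Heegner field with `2` split, `|d_K| > 4`, `L(E^{(d_K)},1) ≠ 0`, carrying the
    -- `≥`-half of the (rank-0, non-surjective) twist at its globally minimal models
    (hSup : ∃ (K : Type) (_ : Field K) (_ : NumberField K), IsImaginaryQuadratic K ∧ 4 < (NumberField.discr K).natAbs ∧
      SatisfiesHeegnerHypothesis (W.conductorNorm ℤ) K ∧ SatisfiesHeegnerHypothesis 2 K ∧
      (W.quadraticTwist (NumberField.discr K : ℚ)).entireLFunction 1 ≠ 0 ∧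
      ∀ (Wd : WeierstrassCurve ℚ) [Wd.IsElliptic] [Wd.IsGloballyMinimal] (Cd : VariableChange ℚ),
        Cd • W.quadraticTwist (NumberField.discr K : ℚ) = Wd → ¬ Surj Wd p → Typed.MissingLowerBoundAt Wd p)
    -- Jₚᶜ: the Jetchev direction `M_∞ ≥ t` on the corner frames of THIS pair (hypothesis shape)
    (hJ : ∀ [NeZero (W.conductorNorm ℤ)] (K : Type) [Field K] [NumberField K]
      (Dt : ModularParametrizationData W (W.conductorNorm ℤ)) (β : ℤ) (ι : K →+* ℂ),
      IsImaginaryQuadratic K → 4 < (NumberField.discr K).natAbs →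
      SatisfiesHeegnerHypothesis (W.conductorNorm ℤ) K → SatisfiesHeegnerHypothesis p K →
      (4 * (W.conductorNorm ℤ : ℤ)) ∣ β ^ 2 - NumberField.discr K → ¬ (p : ℤ) ∣ Dt.c →
      ∀ (s : ℕ), s ≤ padicValNat p W.tamagawaProduct →
        ∀ (n : ℕ) (d : KolyvaginHeegnerData Dt β ι n), Squarefree n →
          (∀ ℓ ∈ n.primeFactors, Zhang2014.IsKolyvaginPrime (W.conductorNorm ℤ) W K p ℓ ∧
            s ≤ Zhang2014.kolyvaginIndex W p ℓ) → PDiv d p s) :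
    Typed.MissingUpperBoundAt W p := by
  have hNS : integral_neronScaling_of_isGloballyMinimal :=
    integral_neronScaling_of_isGloballyMinimal_holds
  haveI : NeZero (W.conductorNorm ℤ) := ⟨(W.conductorNorm_pos_holds).ne'⟩
  have hp : p.Prime := Fact.out
  have hp5 : 5 ≤ p := by rcases h57 with h | h <;> omega
  have hp2 : p ≠ 2 := by omega
  obtain ⟨hr, _, hmult, hirr⟩ := id hX
  -- a Manin-good parametrisation of level N_E (p² ∤ N)
  have hpN : ¬ p ^ 2 ∣ W.conductorNorm ℤ := not_sq_dvd_conductorNorm_of_mult W p hmult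
  obtain ⟨D, hc⟩ := exists_modularParametrizationData_not_dvd hnf hMaz hNS W rfl hp hp2 hpN hirr
  -- the SUPPLIED Heegner field: |d_K| > 4, every ℓ ∣ N_E split (so p ∣ N splits), 2 split, L(E^{d_K},1) ≠ 0, WITH the twin's `≥`-half
  obtain ⟨K, _, _, hK, hdisc, hHN, hH2, hLt, hLtwK⟩ := hSup
  have hHp : SatisfiesHeegnerHypothesis p K :=
    SatisfiesHeegnerHypothesis.of_dvd (dvd_conductorNorm_of_mult hmult) hHN
  have h2K : ¬ (Ideal.span {((2 : ℕ) : 𝓞 K)}).IsPrime := not_isPrime_span_two_of_satisfiesHeegnerHypothesis hH2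
  haveI : IsTotallyComplex K := hK.2
  have hneg : NumberField.discr K < 0 := discr_neg_of_finrank_eq_two K hK.1
  have h4lt : NumberField.discr K < -4 := by
    have habs : ((NumberField.discr K).natAbs : ℤ) = -NumberField.discr K :=
      Int.ofNat_natAbs_of_nonpos hneg.le
    have : (4 : ℤ) < ((NumberField.discr K).natAbs : ℤ) := by exact_mod_cast hdisc
    omega
  have h3 : NumberField.discr K ≠ -3 := by omega
  have h4 : NumberField.discr K ≠ -4 := by omega
  have hμ : ¬ p ∣ Units.torsionOrder K := by
    rw [Literature.NumberTheory.DiophantineGeometry.torsionOrder_eq_two_of_discr_lt hK.1 h4lt]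
    intro h2
    have := Nat.le_of_dvd two_pos h2
    omega
  obtain ⟨H, -⟩ := nonempty_heegnerDatum_holds (W.conductorNorm ℤ) K hK
    (exists_dvd_sq_sub_discr_holds (W.conductorNorm ℤ) K hK hHN).choose_spec
  obtain ⟨ι⟩ : Nonempty (K →+* ℂ) := inferInstance
  obtain ⟨P, hP⟩ := heegnerPointComplex_mem_range_map_holds (W.conductorNorm ℤ) W K hK hHN D H ι
  -- the minimal twist model: an X11a pair ON THE NON-SURJECTIVE LEAF, and its `≥`-half
  have hD0 : (NumberField.discr K : ℚ) ≠ 0 := by exact_mod_cast NumberField.discr_ne_zero K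
  haveI hEt : (W.quadraticTwist (NumberField.discr K : ℚ)).IsElliptic :=
    W.isElliptic_quadraticTwist hD0
  obtain ⟨Cd, hCd⟩ := hasGlobalMinimalModel_rat_holds (W.quadraticTwist (NumberField.discr K : ℚ))
  haveI : (Cd • W.quadraticTwist (NumberField.discr K : ℚ)).IsGloballyMinimal := hCd
  set Wd := Cd • W.quadraticTwist (NumberField.discr K : ℚ) with hWd_def
  have hWd : Cd • W.quadraticTwist (NumberField.discr K : ℚ) = Wd := rfl
  have hrd : Wd.analyticRank = 0 := by
    rw [hWd_def, analyticRank_smul]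
    exact analyticRank_eq_zero_of_entireLFunction_one_ne_zero _ hLt
  have hXa : ClassX11a Wd p := classX11a_twist_of_not_ram W p hX hnr K hK hHN Cd hWd hrd
  have hirrd : Wd.HasIrreducibleModPGaloisRep p := hXa.2.2.2.1
  have hnsd : ¬ Surj Wd p := not_surj_twist_model W p hD0 hns Cd hWd
  have hpN1 : p ∣ W.conductorNorm ℤ := dvd_conductorNorm_of_mult hmult
  have hsq := isSquare_discr_padic_of_heegner K hK hHN p hpN1
  have hvd : p ∣ padicValInt p Wd.minimalDiscriminantInt := by
    rw [padicValInt_minimalDiscriminantInt_twist_eq W p hD0 hsq Cd hWd]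
    exact hv
  obtain ⟨qd, hqd, hvqd⟩ :=
    AdditivePotMult.exists_printShape_lower_of_missingLowerBoundAt_rankZero (p := p) Wd hGZK hrd hirrd
      (hLtwK Wd Cd hWd hnsd)
  have htam : padicValNat p Wd.tamagawaProduct = padicValNat p W.tamagawaProduct :=
    padicValNat_tamagawaProduct_twist_of_heegner W p hp5 K hK hHN Cd hWd
  have hu : padicValRat p (Cd.u : ℚ) = 0 :=
    AdditivePotMult.padicValRat_u_eq_zero_of_twist_minimal_of_split W p K hK hHp Cd hWd
  -- no p-torsion over K (irreducibility)
  have hbot := torsionBy_eq_bot_of_isImaginaryQuadratic_of_hasIrreducibleModPGaloisRep W K hK hp hirr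
  have hiv : ∀ x : (W.baseChange K).toAffine.Point, p • x = 0 → x = 0 := fun x hx ↦ by
    have hmem : x ∈ AddSubgroup.torsionBy (W.baseChange K).toAffine.Point ((p : ℕ) : ℤ) := by
      rw [mem_torsionBy_iff, natCast_zsmul]
      exact hx
    rw [hbot] at hmem
    exact hmem
  -- Darmon's conductor-1 datum on the frame (D, H.β, ι) and its bottom point
  obtain ⟨d₁⟩ := exists_kolyvaginHeegnerData_one (hD36 _ W K) hK D H.β ι H.dvd_sq_sub
  have hPd : d₁.toGeomPoints d₁.derivedPoint = toGeomPoints (W.baseChange K) P :=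
    KolyvaginBottom.toGeomPoints_derivedPoint_one_eq (hrec _ W K) hK hHN hP d₁ rfl
  -- descent to ℚ with weight t = ord_p ∏c (x11b3's sharp bookkeeping)
  refine missingUpperBoundAt_of_shaIndexBound_sharp W p (W.conductorNorm ℤ) K D H ι P (hGZ _ W K)
    (hKo _ W K) hGZK hmod hK hHN hP hp2 hc hμ hr hLt Wd Cd hWd hu htam le_rfl ⟨qd, hqd, hvqd⟩ ?_
  intro hfinK hPinf
  haveI : Finite (W.baseChange K).sha := hfinK
  obtain ⟨hrank, -⟩ := hKo (W.conductorNorm ℤ) W K hK hHN ⟨D, H, ι, hP⟩ hPinf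
  -- `−1 ∈ ρ̄_{E,p}(Γ_ℚ)` at the multiplicative `p ≥ 5` with `E[p]` irreducible (image-free), then Cha Rmk. 25 BY KERNEL at this frame
  have hneg : ∃ γ : absoluteGaloisGroup ℚ, ∀ T : geomTorsion W p, γ • T = -T :=
    ShimuraKolyvaginOfImage.exists_smul_eq_neg_of_mult_of_irr_of_five_le W p hp5 hmult hirr
  exact shaIndexBound_sharp_of_globalDivisibility_of_chaAt W K p D H.β ι P hPinf hrank hiv
    (fun M₀ hM₀div hM₀max t hglob ↦
      ModularHeegnerCha.cha_rmk25_upper_of_neg_of_casselsTate_of_frobeniusCongruence (hCT K) h372 hK h3 h4 hHN h2K hp2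
        hpN1 hirr hneg ι D d₁ hPd hPinf hM₀div hM₀max t hglob)
    (hJ K D H.β ι hK hdisc hHN hHp H.dvd_sq_sub hc)


/-! ### §2 The hybrid composition with no ∀-shaped twin input -/

/-- **`…HybridDeepWitnessCore` §2 with the MAX road's twin-lower input ∃-RECUT** — the last ∀-shaped twin input of the composition leaves: the binder
`h₄ℓ` (the `≥`-half of EVERY non-surjective X11a leaf twin with non-unit `#Ш_an`, fed on the line of record from μ = 0 + six Hida facts, or from crux 19064)
is replaced by `hMaxSup` (per corner pair, ONE Heegner field with `2` split carrying the twist's `≥`-half — §1's supply); the MULTI-carrier road's input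
`hUmulti` is unchanged (the glue feeds it from the inert-frame supply `FHTwinLowerSupplyAt W p`, itself ∃-shaped). The one-prime Friedberg–Hoffstein fact
leaves the composition's binder list (it only chose the MAX frame). Upper half by carrier profile and the converse half from the deep witness VERBATIM.
CONDITIONAL on every binder; does NOT close 19065; nothing booked; T7.
[cite: Miller2011LMS, Def. 1.1] [cite: Cha2005, Thm. 21 and Rmk. 25 (pp. 173–175)] [cite: McCallumLMS1991, §5 Cor. 5.6] -/
theorem erratumRoadFive_nonSurjCorner_of_deepWitness_of_kolyJMax_of_multiUpper_of_maxTwinLowerSupply_of_twinUpper_of_casselsTate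
    (hGZ : ∀ (N : ℕ) [NeZero N] (W : WeierstrassCurve ℚ) (K : Type) [Field K] [NumberField K],
      gross_zagier N W K)
    (hKo : ∀ (N : ℕ) [NeZero N] (W : WeierstrassCurve ℚ) (K : Type) [Field K] [NumberField K],
      kolyvagin N W K)
    (hGZK : rank_eq_analyticRank_of_analyticRank_le_one) (hmod : hasEntireLFunction_rat)
    (hnf : exists_isNewformOf)
    (hMaz : mazur_not_dvd_maninConstant_of_odd)
    (hrec : ∀ (N : ℕ) [NeZero N] (W : WeierstrassCurve ℚ) (K : Type) [Field K] [NumberField K],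
      heegnerPointOfConductor_one_galoisConj N W K)
    (hD36 : ∀ (N : ℕ) [NeZero N] (W : WeierstrassCurve ℚ) (K : Type) [Field K] [NumberField K],
      phi_heegnerTau_mem_singularModuliField N W K)
    (hChaL : Cha2005.rmk25_pow_dvd_card_sha_primary_of_certificate)
    (hCT : ∀ (K : Type) [Field K] [NumberField K], casselsTate_levelInputs K)
    (h372 : GrossLMS1991.prop37_2_frobeniusCongruence)
    -- the MAX-frame twin-lower SUPPLY at every corner pair (∃-shape; used on the `t = 0` ∕ mono-carrier pairs)
    (hMaxSup : ∀ (W : WeierstrassCurve ℚ) [W.IsElliptic] [W.IsGloballyMinimal] (p : ℕ) [Fact p.Prime],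
      ClassX11b W p → ¬ Surj W p → (p = 5 ∨ p = 7) → p ∣ padicValInt p W.minimalDiscriminantInt → ¬ Ram W p →
      ∃ (K : Type) (_ : Field K) (_ : NumberField K), IsImaginaryQuadratic K ∧ 4 < (NumberField.discr K).natAbs ∧
        SatisfiesHeegnerHypothesis (W.conductorNorm ℤ) K ∧ SatisfiesHeegnerHypothesis 2 K ∧
        (W.quadraticTwist (NumberField.discr K : ℚ)).entireLFunction 1 ≠ 0 ∧
        ∀ (Wd : WeierstrassCurve ℚ) [Wd.IsElliptic] [Wd.IsGloballyMinimal] (Cd : VariableChange ℚ),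
          Cd • W.quadraticTwist (NumberField.discr K : ℚ) = Wd → ¬ Surj Wd p → Typed.MissingLowerBoundAt Wd p)
    (hJmax : ∀ (W : WeierstrassCurve ℚ) [W.IsElliptic] [W.IsGloballyMinimal] [NeZero (W.conductorNorm ℤ)]
      (p : ℕ) [Fact p.Prime] (K : Type) [Field K] [NumberField K]
      (Dt : ModularParametrizationData W (W.conductorNorm ℤ)) (β : ℤ) (ι : K →+* ℂ),
      p ∣ W.tamagawaProduct →
      ClassX11b W p → ¬ Surj W p → (p = 5 ∨ p = 7) → p ∣ padicValInt p W.minimalDiscriminantInt →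
      ¬ Ram W p → IsImaginaryQuadratic K → 4 < (NumberField.discr K).natAbs →
      SatisfiesHeegnerHypothesis (W.conductorNorm ℤ) K → SatisfiesHeegnerHypothesis p K →
      (4 * (W.conductorNorm ℤ : ℤ)) ∣ β ^ 2 - NumberField.discr K → ¬ (p : ℤ) ∣ Dt.c →
      ∀ (v : HeightOneSpectrum (𝓞 ℚ)) (s : ℕ), s ≤ padicValNat p (W.tamagawaNumberAt v) →
        ∀ (n : ℕ) (d : KolyvaginHeegnerData Dt β ι n), Squarefree n →
          (∀ ℓ ∈ n.primeFactors, Zhang2014.IsKolyvaginPrime (W.conductorNorm ℤ) W K p ℓ ∧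
            s ≤ Zhang2014.kolyvaginIndex W p ℓ) → PDiv d p s)
    (hUmulti : ∀ (W : WeierstrassCurve ℚ) [W.IsElliptic] [W.IsGloballyMinimal] (p : ℕ) [Fact p.Prime],
      ClassX11b W p → ¬ Surj W p → (p = 5 ∨ p = 7) → p ∣ padicValInt p W.minimalDiscriminantInt →
      ¬ Ram W p → p ∣ W.tamagawaProduct →
      (∀ v : HeightOneSpectrum (𝓞 ℚ), padicValNat p (W.tamagawaNumberAt v) < padicValNat p W.tamagawaProduct) →
      Typed.MissingUpperBoundAt W p)
    -- the twin's Euler half from the μ-clause, class-wide in SHAPE (Kato 12.4 + §17.13 + SW 6.1 + GS in the glue; consumed only at the witness twin)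
    (htwU : ∀ (Wd : WeierstrassCurve ℚ) [Wd.IsElliptic] [Wd.IsGloballyMinimal] (p : ℕ) [Fact p.Prime],
      ClassX11a Wd p → ¬ Surj Wd p → p ∣ padicValInt p Wd.minimalDiscriminantInt →
      (∀ {N : ℕ} [NeZero N] (f : CuspForm (Gamma0 N) 2), IsNewformOf Wd f →
        ∀ (ϖ : ℚ), (ϖ : ℝ) * Wd.realPeriodRat = plusPeriod f →
        ∀ (a : ℚ_[p]) (L : PowerSeries ℚ_[p]),
          (Wd.HasSplitMultiplicativeReductionAtPrime p → a = 1) →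
          (¬ Wd.HasSplitMultiplicativeReductionAtPrime p → a = -1) →
          IsMultPAdicLFunctionOf f p a L →
          ∃ n : ℕ, ‖PowerSeries.coeff n (PowerSeries.C ((ϖ : ℚ) : ℚ_[p]) * L)‖ = 1) →
      Typed.MissingUpperBoundAt Wd p)
    -- ONE DEEP WITNESS per deep corner pair (slots 1 + 2b of r18, ∃-recut)
    (hWit : ∀ (W : WeierstrassCurve ℚ) [W.IsElliptic] [W.IsGloballyMinimal] (p : ℕ) [Fact p.Prime],
      ClassX11b W p → ¬ Surj W p → (p = 5 ∨ p = 7) → p ∣ padicValInt p W.minimalDiscriminantInt →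
      ¬ Ram W p → (∃ s : ℚ, shaAn W = (s : ℂ) ∧ 0 < padicValRat p s) →
      ∃ (N : ℕ) (_ : NeZero N) (K : Type) (_ : Field K) (_ : NumberField K)
        (Dt : ModularParametrizationData W N) (H : HeegnerDatum N (NumberField.discr K)) (ι : K →+* ℂ)
        (P : (W.baseChange K).toAffine.Point),
        W.conductorNorm ℤ = N ∧ IsImaginaryQuadratic K ∧ 4 < (NumberField.discr K).natAbs ∧
        SatisfiesHeegnerHypothesis N K ∧ (W.quadraticTwist (NumberField.discr K : ℚ)).entireLFunction 1 ≠ 0 ∧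
        WeierstrassCurve.Affine.Point.map ι.toRatAlgHom P = heegnerPointComplex Dt H ∧ ¬ (p : ℤ) ∣ Dt.c ∧
        -- (i) at THIS frame, if it is deep, a refined-Kolyvagin certificate of level ≤ t (a shallow frame certifies itself)
        ((∃ (d₁ : KolyvaginHeegnerData Dt H.β ι 1) (y : (W.baseChange K).toAffine.Point),
            WeierstrassCurve.Affine.Point.map (W' := W) (algebraMap K (ringClassField K ι 1)).toRatAlgHom y =
              d₁.derivedPoint ∧
            ∃ Q : (W.baseChange K).toAffine.Point, ((p ^ (padicValNat p W.tamagawaProduct + 1) : ℕ) : ℤ) • Q = y) →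
          ∃ M : ℕ, M ≤ padicValNat p W.tamagawaProduct ∧ CertificateAt Dt H.β ι p M) ∧
        -- (ii) analytic μ = 0 (19948's allowable-root clause) at the globally minimal models of THIS twist E^{(d_K)}
        (∀ (Wd : WeierstrassCurve ℚ) [Wd.IsElliptic] [Wd.IsGloballyMinimal] (Cd : VariableChange ℚ),
          Cd • W.quadraticTwist (NumberField.discr K : ℚ) = Wd →
          ClassX11a Wd p → ¬ Surj Wd p → p ∣ padicValInt p Wd.minimalDiscriminantInt →
          ∀ {N : ℕ} [NeZero N] (f : CuspForm (Gamma0 N) 2), IsNewformOf Wd f →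
          ∀ (ϖ : ℚ), (ϖ : ℝ) * Wd.realPeriodRat = plusPeriod f →
          ∀ (a : ℚ_[p]) (L : PowerSeries ℚ_[p]),
            (Wd.HasSplitMultiplicativeReductionAtPrime p → a = 1) →
            (¬ Wd.HasSplitMultiplicativeReductionAtPrime p → a = -1) →
            IsMultPAdicLFunctionOf f p a L →
            ∃ n : ℕ, ‖PowerSeries.coeff n (PowerSeries.C ((ϖ : ℚ) : ℚ_[p]) * L)‖ = 1)) :
    Summit.BirchSwinnertonDyer.BirchSwinnertonDyer.Theses.ErratumRoadFive.NonSurjCorner := by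
  intro W _ _ p _ hX hns h57 hv hnr
  have hp5 : 5 ≤ p := by rcases h57 with h | h <;> omega
  haveI : NeZero (W.conductorNorm ℤ) := ⟨(W.conductorNorm_pos_holds).ne'⟩
  -- the UPPER half, by CARRIER PROFILE — MAX road on the supplied frame (t = 0 ∕ mono-carrier), `hUmulti` on multi-carrier pairs
  have hupper : Typed.MissingUpperBoundAt W p := by
    by_cases hcase : ¬ p ∣ W.tamagawaProduct ∨
        ∃ v : HeightOneSpectrum (𝓞 ℚ), padicValNat p W.tamagawaProduct ≤ padicValNat p (W.tamagawaNumberAt v)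
    · refine missingUpperBoundAt_corner_of_jetchevDivisibility_of_maxTwinLowerSupply_of_casselsTate hGZ hKo hGZK hmod hnf hMaz
        hrec hD36 hCT h372 W p hX hns h57 hv hnr (hMaxSup W p hX hns h57 hv hnr) ?_
      intro _ K _ _ Dt β ι hK hdisc hHN hHp hβ hc s hs n d hn hℓ
      rcases hcase with htam | ⟨v, hvt⟩
      · exact Summit.BirchSwinnertonDyer.BirchSwinnertonDyer.Theorems.nonSurjCornerKolyJ_of_not_dvd_tamagawa W p K
          Dt β ι htam hX hns h57 hv hnr hK hdisc hHN hHp hβ hc s hs n d hn hℓ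
      · by_cases htam : p ∣ W.tamagawaProduct
        · exact hJmax W p K Dt β ι htam hX hns h57 hv hnr hK hdisc hHN hHp hβ hc v s (hs.trans hvt) n d hn hℓ
        · exact Summit.BirchSwinnertonDyer.BirchSwinnertonDyer.Theorems.nonSurjCornerKolyJ_of_not_dvd_tamagawa W p K
            Dt β ι htam hX hns h57 hv hnr hK hdisc hHN hHp hβ hc s hs n d hn hℓ
    · push Not at hcase
      exact hUmulti W p hX hns h57 hv hnr hcase.1 hcase.2
  -- the LOWER half: trivial when `ord_p #Ш(E)_an ≤ 0`; otherwise the DEEP WITNESS of this pair (§1)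
  obtain ⟨s, hs, hsv⟩ := hupper
  by_cases hs0 : padicValRat p s ≤ 0
  · exact Typed.missingPPartAt_of_lower_of_upper W p (missingLowerBoundAt_of_shaAn_nonpos W p hs hs0) ⟨s, hs, hsv⟩
  have hspos : ∃ s : ℚ, shaAn W = (s : ℂ) ∧ 0 < padicValRat p s := ⟨s, hs, lt_of_not_ge hs0⟩
  exact Typed.missingPPartAt_of_lower_of_upper W p
    (missingLowerBoundAt_corner_of_deepWitnessAt hGZ hKo hGZK hmod hrec hD36 hChaL W p hX hns h57 hv hnr
      (fun Wd _ _ hXa hnsd hvd hμc ↦ htwU Wd p hXa hnsd hvd hμc) (hWit W p hX hns h57 hv hnr hspos))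
    ⟨s, hs, hsv⟩

end Summit.BirchSwinnertonDyer.Rank1Residual.X11b

end
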